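import Summits.ResolutionOfSingularities.ResolutionOfSingularities.Theorems.LossEntryW05
import HarnessLib

/-!
# LossEntryW06 — walk plumbing of the loss→entry law `LawLossEntry`, part 6/11

decomp-res-lens-3, gen 29 (HOME/decomp-res-lens-3/g29/NODE-g29.md).  TOOL at 0 toward the residual item
stmt-ResolutionOfSingularities-27367 (`WallCut.NoLossyStrictTailsDeep` ⟸ `LossEpisode.LawLossEntry`).  Imports part 5 (`Theorems.LossEntryW05`, to be landed first).

Contents: §10 `polyPts_succ_loss_c`, `exists_axisWitness_loss_c`, LAW `lawLossEntryAt_of_loss_c`.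
-/

open MvPolynomial Finset
open Literature.AlgebraicGeometry.Resolution
open Literature.AlgebraicGeometry.Resolution.Hauser2010
open Literature.AlgebraicGeometry.Resolution.PointBlowup
open Summit.ResolutionOfSingularities.ResolutionOfSingularities.Theorems.TightDefectClasses
open Summit.ResolutionOfSingularities.ResolutionOfSingularities.Theorems.TightDefectStrongWalks
open Summit.ResolutionOfSingularities.ResolutionOfSingularities.Theorems.ItineraryCutClasses
open Summit.ResolutionOfSingularities.ResolutionOfSingularities.Theorems.BoundaryLedger
open Summit.ResolutionOfSingularities.ResolutionOfSingularities.Theorems.ProximityCut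
open Summit.ResolutionOfSingularities.ResolutionOfSingularities.Theorems.LossIsFatalLayer (chartMap chartMap_X chartMap_X_self
  chartMap_X_ne chartMap_C)
open Summit.ResolutionOfSingularities.ResolutionOfSingularities.Theorems.LossExitCone
open Summit.ResolutionOfSingularities.ResolutionOfSingularities.Theorems.LossPolygon

/-! ## §10 The polygon identity, the transported axis witness and the law for a (c)-loss followed by a repeat -/

namespace Summit.ResolutionOfSingularities.ResolutionOfSingularities.Theorems.LossEpisode

variable {K : Type} [Field K] [DecidableEq K] {q : ℕ} {s₀ : State (Fin 3) K}

section WalkC2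

variable {W : ForcedWalk q s₀} {N s : ℕ}

/-- **POLYGON IDENTITY, CASE (c) (PROVED):** after a (c)-loss in the chart `l` the polygon of the one-wall state
(frame `(l, i; j)`) is the entry set of the cleaned (c)-prepared equation `σ_{i,l,b_t(i)} σ_{j,l,b_t(j)} F_t` with section letter
`i` and ceiling letter `j`. [new] -/
theorem polyPts_succ_loss_c (hroot : IsRoot q s₀) (t : ℕ) {i j l : Fin 3} {k m : ℕ}
    (hS : IsRunState W s t i j l k m) (hjt : W.j t = l) {T : ℕ} (hr1 : (W.st (t + 1)).r = Finsupp.single l T)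
    (hTo : q + T = k + m + s) :
    polyPts s (W.st (t + 1)).r l i j (W.st (t + 1)).F =
      entryPts s (k + m + s) i j (deletePthPowers q (shear i l (W.b t i) (shear j l (W.b t j) (W.st t).F))) := by
  classical
  have hij : i ≠ j := hS.1
  have hli : l ≠ i := hS.2.1
  have hlj : l ≠ j := hS.2.2.1
  have hr₁l : (W.st (t + 1)).r l = T := by rw [hr1, Finsupp.single_eq_same]
  have hr₁i : (W.st (t + 1)).r i = 0 := by rw [hr1, Finsupp.single_apply, if_neg hli]
  have hr₁j : (W.st (t + 1)).r j = 0 := by rw [hr1, Finsupp.single_apply, if_neg hlj]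
  have hsupp := support_succ_two_shears hroot W t hli.symm (Ne.symm hlj) hij hjt
  ext x
  simp only [polyPts, entryPts, Finset.mem_image, Finset.mem_filter]
  constructor
  · rintro ⟨D, ⟨hD, hDj⟩, rfl⟩
    rw [hsupp, Finset.mem_image] at hD
    obtain ⟨E, hE, rfl⟩ := hD
    have hEsupp := (Finset.mem_filter.mp hE).1
    have hqE : q ≤ E.degree := le_degree_of_mem_support_two_shears hroot W t l i j _ _ hEsupp
    refine ⟨E, ⟨by rw [support_deletePthPowers']; exact hE, ?_⟩,
      (resPoint_chartExponent_eq_entryPt hli.symm hlj hr₁l hr₁i hr₁j hTo hqE).symm⟩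
    rw [chartExponent_apply, if_neg (Ne.symm hlj), hr₁j, add_zero] at hDj
    exact hDj
  · rintro ⟨E, ⟨hE, hEj⟩, rfl⟩
    rw [support_deletePthPowers'] at hE
    have hEsupp := (Finset.mem_filter.mp hE).1
    have hqE : q ≤ E.degree := le_degree_of_mem_support_two_shears hroot W t l i j _ _ hEsupp
    refine ⟨chartExponent q l E, ⟨?_, ?_⟩, resPoint_chartExponent_eq_entryPt hli.symm hlj hr₁l hr₁i hr₁j hTo hqE⟩
    · rw [hsupp]; exact Finset.mem_image_of_mem _ hE
    · rw [chartExponent_apply, if_neg (Ne.symm hlj), hr₁j, add_zero]; exact hEj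

/-- **AXIS WITNESS, CASE (c) (PROVED):** the `(l,j)`-axis law of `F_{t+1}` gives a monomial `u^E` of the cleaned (c)-prepared
equation with `deg E + E j < 2q`; transporting it through `swapShear j l ν λ` (`E' l ≤ E j`, `LossShearX2Line.exists_dom_swapShear`)
and through the outer shear `σ_{i,l,β}` (`D l ≤ E' l`, `exists_dom_of_mem_support_shear`) gives a monomial `u^R` of the
cleaned (b)-type equation `σ_{i,j,βλ} σ_{l,j,λ} F_t` with `deg R + R l < 2q`, `R l < s`. [new] -/
theorem exists_axisWitness_loss_c (hroot : IsRoot q s₀) (hT : TailHyp W N s) {t : ℕ} (hNt : N ≤ t) {i j l : Fin 3}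
    {k m : ℕ} (hS : IsRunState W s t i j l k m) (hjt : W.j t = l) {lam : K} (hlam : lam ≠ 0)
    (hνl : W.b t j * lam = 1) (hos : 2 * q + 1 ≤ k + m + s + s)
    (hLucas : ∀ D T : ℕ, q ∣ D → ¬ q ∣ T → ((D.choose T : ℕ) : K) = 0) :
    ∃ R ∈ (deletePthPowers q (shear i j (W.b t i * lam) (shear l j lam (W.st t).F))).support,
      R.degree + R l < 2 * q ∧ R l < s := by
  classical
  have hij : i ≠ j := hS.1
  have hli : l ≠ i := hS.2.1
  have hlj : l ≠ j := hS.2.2.1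
  have hν : W.b t j ≠ 0 := left_ne_zero_of_mul_eq_one hνl
  obtain ⟨M, hM, hMlj⟩ := ConeCutAxisLaw.axis_law W (t + 1) l j hlj
  rw [support_succ_two_shears hroot W t hli.symm (Ne.symm hlj) hij hjt, Finset.mem_image] at hM
  obtain ⟨E, hE, rfl⟩ := hM
  have hEsupp := (Finset.mem_filter.mp hE).1
  have hqE : q ≤ E.degree := le_degree_of_mem_support_two_shears hroot W t l i j _ _ hEsupp
  rw [chartExponent_apply, if_pos rfl, chartExponent_apply, if_neg (Ne.symm hlj)] at hMlj
  have hEc : E ∈ (deletePthPowers q (shear i l (W.b t i) (shear j l (W.b t j) (W.st t).F))).support := by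
    rw [support_deletePthPowers']; exact hE
  obtain ⟨E', hE', -, hE'deg, hE'l⟩ := exists_dom_swapShear hij hli.symm (Ne.symm hlj) hν hlam hLucas _ hEc
  rw [swapShear_shear_shear hij hli.symm (Ne.symm hlj) hνl (W.b t i) (W.st t).F] at hE'
  obtain ⟨D, hD, -, hDdeg, hDor⟩ := exists_dom_of_mem_support_shear hlj hli hij.symm hLucas (W.b t i) _ hE'
  have hDl : D l ≤ E' l := by
    rcases hDor with rfl | hlt
    · exact le_rfl
    · exact hlt.le
  have hoD : k + m + s ≤ D.degree := by
    have hD' := hD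
    rw [support_deletePthPowers'] at hD'
    exact le_degree_of_mem_support_prepared hroot hT hNt hS _ _ (Finset.mem_filter.mp hD').1
  refine ⟨D, hD, by omega, by omega⟩

/-- **LAW (L_E), CASE (c) (PROVED): LOSS IN THE CHART OF THE FREE LETTER + REPEAT ⇒ THE NEXT RUN STATE HAS STRICTLY SMALLER `β`.**
From a heavy run state `(i,j,l;k,m)` on the tail, a loss at `t` in the chart `l` (`b_t(i) ≠ 0`, `b_t(j) ≠ 0`) followed by a
proximity repeat lands at `t + 2` in the run state `(i, l, j ; d, T)`.  The repeat is the untranslated `u_i`-chart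
(`repeat_after_loss_c`), so `β_{t+2} = α + β − 1` of the entry set `EP_c` of the (c)-prepared equation (`polyPts_succ_loss_c`,
`polyPts_succ_chart_snd`).  The lex-minimal vertex of `EP_c` equals that of the entry set of `swapShear j l ν λ (G_c) = σ_{i,l,β} G_b'`
(two-sided domination `exists_dom_swapShear`, an involution by `swapShear_swapShear`) and that of the (b)-type equation
`G_b' = σ_{i,j,βλ} σ_{l,j,λ} F_t` (outer-shear dominations; degree-`o` monomials of `G_b'` sit on the ceiling by
`thd_eq_of_mem_support_two_shears`), to which the entry law T8b `entry_lt_betaOf_of_axisWitness` applies with `φ = βλ`, `g = λ`.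
[CJS2020 Lemma 13.4 for the walk, (c)-presentation; new] -/
theorem lawLossEntryAt_of_loss_c (hroot : IsRoot q s₀) (hT : TailHyp W N s)
    (hLucas : ∀ D T : ℕ, q ∣ D → ¬ q ∣ T → ((D.choose T : ℕ) : K) = 0) {t : ℕ} (hNt : N ≤ t) {i j l : Fin 3}
    {k m : ℕ} (hS : IsRunState W s t i j l k m) (hm : q ≤ m + s) (hjt : W.j t = l) (hbi : W.b t i ≠ 0) (hbj : W.b t j ≠ 0)
    (hloss : IsLossMove W t) (hst : StaysOnNewest W t) :
    ∃ u : ℕ, t < u ∧ ∃ (i' j' l' : Fin 3) (k' m' : ℕ), IsRunState W s u i' j' l' k' m' ∧ q ≤ m' + s ∧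
      runBeta W s u i' j' l' < runBeta W s t i j l := by
  classical
  obtain ⟨hord, hq, hks, hms, -⟩ := runState_ledger hroot hT hNt hS
  obtain ⟨hri, hrj, hrl⟩ := hS.r_apply
  have hij : i ≠ j := hS.1
  have hli : l ≠ i := hS.2.1
  have hlj : l ≠ j := hS.2.2.1
  have hsq : s < q := hT.s_lt
  have h1s : 1 ≤ s := hT.one_le
  obtain ⟨φ₀, lam, hφ₀, hlam, hνl, hpen⟩ := pencil_of_loss_c hroot hT hNt hS hjt
  have hro : (W.st t).r.degree + s = k + m + s := by
    rw [hS.2.2.2.2.2.1, map_add, Finsupp.degree_single, Finsupp.degree_single]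
  obtain ⟨T, hoT, h1T, hr1, hqT, hnext⟩ := lossMove_next hroot hT hNt hloss
  have hTo : q + T = k + m + s := by
    have h := hord.symm.trans hoT
    have h' : s + k + m = q + T := by exact_mod_cast h
    omega
  rcases hnext with ⟨hnst, -, -⟩ | ⟨-, l₂, d, hl₂i, hl₂j, hTd, h1d, hS2⟩
  · exact absurd hst hnst
  obtain ⟨hci, hb1⟩ := repeat_after_loss_c hroot hT hNt hS hjt hbi hbj hloss hst
  rw [hci] at hS2 hl₂i
  rw [hjt] at hS2 hl₂j hr1
  have hl₂ : l₂ = j := by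
    rcases fin3_eq_or i j l l₂ hij hli.symm (Ne.symm hlj) with h | h | h
    · exact absurd h hl₂i
    · exact h
    · exact absurd h hl₂j
  rw [hl₂] at hS2
  have hS2' : IsRunState W s (t + 1 + 1) i l j d T := hS2
  refine ⟨t + 1 + 1, by omega, i, l, j, d, T, hS2', hqT.le, ?_⟩
  -- the two polygon identities
  obtain ⟨hr₂i, hr₂l, hr₂j⟩ := hS2'.r_apply
  have hr₁l : (W.st (t + 1)).r l = T := by rw [hr1, Finsupp.single_eq_same]
  have hr₁i : (W.st (t + 1)).r i = 0 := by rw [hr1, Finsupp.single_apply, if_neg hli]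
  have hr₁j : (W.st (t + 1)).r j = 0 := by rw [hr1, Finsupp.single_apply, if_neg hlj]
  have hP2 : polyPts s (W.st (t + 1 + 1)).r l i j (W.st (t + 1 + 1)).F =
      (polyPts s (W.st (t + 1)).r l i j (W.st (t + 1)).F).image psi01 :=
    polyPts_succ_chart_snd hroot W (t + 1) hli hlj hij hci hb1 (by rw [hr₂l, hr₁l])
      (by rw [hr₂i, hr₁l, hr₁i]; omega) hr₁j hr₂j
  have hP1 := polyPts_succ_loss_c hroot t hS hjt hr1 hTo
  -- the three prepared equations
  set Gc : MvPolynomial (Fin 3) K := shear i l (W.b t i) (shear j l (W.b t j) (W.st t).F) with hGc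
  set Gb : MvPolynomial (Fin 3) K := shear i j (W.b t i * lam) (shear l j lam (W.st t).F) with hGb
  have hSw : swapShear j l (W.b t j) lam Gc = shear i l (W.b t i) Gb :=
    swapShear_shear_shear hij hli.symm (Ne.symm hlj) hνl (W.b t i) (W.st t).F
  have hSw' : swapShear l j lam (W.b t j) (shear i l (W.b t i) Gb) = Gc := by
    rw [← hSw, swapShear_swapShear hij hli.symm (Ne.symm hlj) hνl]
  -- degrees
  have hoGc : ∀ E ∈ (deletePthPowers q Gc).support, k + m + s ≤ E.degree := fun E hE => by
    rw [support_deletePthPowers'] at hE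
    exact le_degree_of_mem_support_prepared_c hroot hT hNt hS _ _ (Finset.mem_filter.mp hE).1
  have hoGb : ∀ D ∈ (deletePthPowers q Gb).support, k + m + s ≤ D.degree := fun D hD => by
    rw [support_deletePthPowers'] at hD
    exact le_degree_of_mem_support_prepared hroot hT hNt hS _ _ (Finset.mem_filter.mp hD).1
  have hoS : ∀ E' ∈ (deletePthPowers q (shear i l (W.b t i) Gb)).support, k + m + s ≤ E'.degree := fun E' hE' => by
    rw [support_deletePthPowers'] at hE'
    exact le_degree_of_mem_support_shear hlj hli hij.symm (W.b t i)
      (fun D hD => le_degree_of_mem_support_prepared hroot hT hNt hS _ _ hD) (Finset.mem_filter.mp hE').1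
  -- no degree-`o` monomial of `Gb` lies below the ceiling
  have hthd : ∀ D ∈ (deletePthPowers q Gb).support, D l < s → k + m + s < D.degree := by
    intro D hD hDl
    rcases (hoGb D hD).lt_or_eq with hlt | heq
    · exact hlt
    · exfalso
      rw [support_deletePthPowers'] at hD
      have := thd_eq_of_mem_support_two_shears hij hli.symm (Ne.symm hlj) hrl hro φ₀ lam (W.b t i * lam)
        (walk_r hroot W t) hpen (Finset.mem_filter.mp hD).1 heq.symm
      omega
  -- the axis witness makes `EP(Gb)` nonempty
  have hos : 2 * q + 1 ≤ k + m + s + s := by omega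
  obtain ⟨R, hR, hax, hRl⟩ := exists_axisWitness_loss_c hroot hT hNt hS hjt hlam hνl hos hLucas
  have hneEPb : (entryPts s (k + m + s) i l (deletePthPowers q Gb)).Nonempty := ⟨_, entryPt_mem_entryPts _ _ _ _ _ hR hRl⟩
  -- vertex transport `EP(Gb; i,l) = EP(σ_{i,l,β} Gb; i,l)` (outer shear) …
  have h32 := vertexOf_entryPts_eq_of_dom (s := s) (o := k + m + s) (a := i) (c := l) (a' := i) (c' := l)
    (G := deletePthPowers q Gb) (G' := deletePthPowers q (shear i l (W.b t i) Gb))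
    (fun D hD hDl => by
      obtain ⟨E', hE', -, hE'deg, hE'or⟩ := exists_dom_shear_of_mem_support hlj hli hij.symm hLucas (W.b t i) Gb hD
      rcases hE'or with rfl | hlt
      · exact ⟨_, hE', hDl, le_rfl⟩
      · exact ⟨E', hE', by omega, toLex_entryPt_le_of_lt hE'deg (hthd D hD hDl) hlt hDl⟩)
    (fun E' hE' hE'l => by
      obtain ⟨D, hD, -, hDdeg, hDor⟩ := exists_dom_of_mem_support_shear hlj hli hij.symm hLucas (W.b t i) Gb hE'
      rcases hDor with rfl | hlt
      · exact ⟨_, hD, hE'l, le_rfl⟩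
      · have hDl : D l < s := by omega
        exact ⟨D, hD, hDl, toLex_entryPt_le_of_lt hDdeg (by rw [← hDdeg]; exact hthd D hD hDl) hlt hE'l⟩)
    hneEPb
  -- … and `EP(σ_{i,l,β} Gb; i,l) = EP(Gc; i,j)` (the swap, both ways)
  have h21 := vertexOf_entryPts_eq_of_dom (s := s) (o := k + m + s) (a := i) (c := l) (a' := i) (c' := j)
    (G := deletePthPowers q (shear i l (W.b t i) Gb)) (G' := deletePthPowers q Gc)
    (fun E' hE' hE'l => by
      obtain ⟨E, hE, hEi, hEdeg, hEj⟩ := exists_dom_swapShear hli.symm hij hlj hlam hbj hLucas _ hE'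
      rw [hSw'] at hE
      exact ⟨E, hE, by omega, toLex_entryPt_le hEdeg (hoS E' hE') hEi.le hEj hE'l⟩)
    (fun E hE hEj => by
      obtain ⟨E', hE', hE'i, hE'deg, hE'l⟩ := exists_dom_swapShear hij hli.symm (Ne.symm hlj) hbj hlam hLucas Gc hE
      rw [hSw] at hE'
      exact ⟨E', hE', by omega, toLex_entryPt_le hE'deg (hoGc E hE) hE'i.le hE'l hEj⟩)
    h32.1
  have hV : vertexOf (entryPts s (k + m + s) i j (deletePthPowers q Gc)) =
      vertexOf (entryPts s (k + m + s) i l (deletePthPowers q Gb)) := by rw [h32.2, h21.2]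
  have hneEPc : (entryPts s (k + m + s) i j (deletePthPowers q Gc)).Nonempty := h21.1
  -- the entry law T8b for `Gb`
  have hqj : q ≤ s + (W.st t).r j := by rw [hrj]; omega
  have h8 := entry_lt_betaOf_of_axisWitness hij hli.symm (Ne.symm hlj) hrl (mul_ne_zero hbi hlam) lam
    (fun D hD => not_isPthPowerExponent_of_mem_support hroot W t hD) (walk_r hroot W t)
    (fun D hD => by rw [hri, hrj]; exact le_degree_of_mem_support_runState hroot hT hNt hS hD)
    (polyPts_nonempty_of_heavy_fst hroot W t (Ne.symm hlj) i hqj hrl)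
    (alphaOf_polyPts_lt_one hroot W t (Ne.symm hlj) i hqj hrl) hsq (by rw [hri, hrj]; omega) (by rw [hri, hrj]; omega)
    hR hax
  rw [hri, hrj] at h8
  unfold runBeta
  rw [hP2, betaOf_image_psi01 (by rw [hP1]; exact hneEPc), hP1]
  unfold alphaOf betaOf at h8 ⊢
  rw [hV]
  exact h8

end WalkC2

end Summit.ResolutionOfSingularities.ResolutionOfSingularities.Theorems.LossEpisode
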